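import Summits.Schanuel.Schanuel.Theorems.RootDecomp1BTwoRadical02

/-!
# RootDecomp1BTwoRadical — lens 4, generation 44, node 2 (g44b) «TWO-RADICAL DESCENT — t(1, ρ) = 5 AT THE RATIONAL COLUMN FOR EVERY ULTRA-LIOUVILLE ρ, HYPOTHESIS-FREE» (lanes B-R29 (ii) ∩ B-R30 (iv)/(d); CLAIM L2259, NODE L2268 / REQUEST L2269; critic VERDICT pending at staging — filed only on GO) — continuation (RootDecomp1BTwoRadical03): §D2 part 1 — the clash engine `twoRadical_clash` (census cap edition)

(lens-4 g44b HOME kernel K = HOME/decomp-schanuel-lens-4/g44b/TwoRadical.lean b925f14a…, 1327 l, imports tree `…RootDecomp1BFactDischarge01` ONLY; P/C per NODE.md. Port by census-1 gen 19 as `RootDecomp1BTwoRadical01`–`05` from the CENSUS CAP EDITION TwoRadical.capped.lean (census/tools/gen19/ports/tr/; = K with steps (2)–(5) of the kernel extracted as the public lemma `twoRadical_clash`, kernel statement BYTE-IDENTICAL, 53/53 decls identical + 1 new — same cut as TwoStorey's, RESHAPE RULE L1684): 01 = §A2 formal algebra of TWO radicals (`fiber_sum₂`, `powSubst₂`, `residue_lemma₂`,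 the q²×q² norm form `radMat₂`, `det_radMat₂_ne_zero`, `det_eq_eigen_mul₂`); 02 = §C2 the specialisation (`Cf₂`, `Frel₂`, sizes, Lipschitz, `eigen_eq_Frel₂` — TwoRadical's own versions, namespace-distinct from TwoStorey's); 03 = §D2 part 1: the private helper + the CLASH ENGINE `twoRadical_clash`; 04 = §D2 part 2: THE KERNEL `algebraicIndependent_twoRadical` (scoped `maxHeartbeats 1600000` as in K); 05 = §E2 cells mod `(hLW : LWMeasure)` + §F2 hypothesis-free via `lwMeasure_holds` (`five_le_polarDeg_one_ultra : ((5 : ℕ) : Cardinal) ≤ polarDeg ![(1:ℝ), ρ]` for EVERY ultra-Liouville ρ, `five_le_polarDeg_one_rhoU`, …) + §G2 the coordinate column at every storey (`polarDeg_snoc_ultra₂`, …).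
PORT EDITS: linter option dropped; one docstring added (`powSubst₂_apply`); §D2 re-cut for the 400-line cap (one new public lemma `twoRadical_clash`; eigenvector coordinates abstracted as `w` with `‖w c‖ ≤ Θ^q·Θ^q`, eigenvalue as `Φ`; thirteen now-unused local `have`s of the kernel dropped); every other statement and proof verbatim. `--supports stmt-Schanuel-24622`; no census credit carried; rung 0 — nothing here proves Schanuel.)
-/

noncomputable section

open Complex

namespace Summit.Schanuel.Schanuel.Theorems.RootDecomp1BTwoRadical

/-! ## §D2 THE KERNEL THEOREM: two-radical descent -/

section Kernel

open MvPolynomial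
open Summit.Schanuel.Schanuel.Theorems.RootDecomp1KHyper (mvlen mvlen_nonneg one_le_mvlen exists_ball_eval_ne_zero)
open RootDecomp1BRadicalDescent (resFin DExpMeasure UltraLiouville exists_int_relation norm_mvaeval_le_mvlen
  totalDegree_det_le mvlen_det_le adjugate_bounds kernel_clash_ineq)

variable {n : ℕ}

/-- `x^k ≤ exp (k x)` for `x ≥ 0` (local copy of the file-private g30 helper). -/
private theorem pow_le_exp_mul {x : ℝ} (hx : 0 ≤ x) (k : ℕ) : x ^ k ≤ Real.exp (k * x) := by
  rw [Real.exp_nat_mul]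
  exact pow_le_pow_left₀ hx (by linarith [Real.add_one_le_exp x]) k

/-- **THE CLASH ENGINE of the two-radical descent** (steps (2)–(5) of the kernel below, stated on their own
for the tree's 400-line file cap — census port edition, proof text verbatim from lens-4 g44's
`algebraicIndependent_twoRadical`; everything at `Q := q²` in place of g30's `q`): given the degree-uniform
measure of `θ` (exponent `A₀`), a nonzero norm form `N = det M` on `Fin (q·q)` with the entry/length/degree bounds,
its evaluation `Mθ` with the EIGEN-FACTORISATION `det Mθ = Φ · Σ_c adj(Mθ)_{z c} w_c` where `‖w_c‖ ≤ Θ^q·Θ^q`,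
a small eigenvalue `‖Φ‖ ≤ q^J · Kl · dJ`, `dJ ≤ exp(−exp((q²)^{A+1}))`, and `q² ≥ Q₁ > c₃ + 2 + a`, the measure and
the factorisation CLASH (`kernel_clash_ineq` of `RootDecomp1BRadicalDescent03` at `q·q`). -/
theorem twoRadical_clash {q : ℕ} (hq : 0 < q) {θ : Fin n → ℂ} {A₀ : ℕ}
    (hA₀ : ∀ P : MvPolynomial (Fin n) ℤ, P ≠ 0 →
      Real.exp (-((Real.log (mvlen P : ℝ) + 1) * Real.exp ((A₀ : ℝ) * ((P.totalDegree : ℝ) + 1) ^ A₀))) ≤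
        ‖MvPolynomial.aeval θ P‖)
    {N : MvPolynomial (Fin n) ℤ} (hN0 : N ≠ 0)
    {M : Matrix (Fin (q * q)) (Fin (q * q)) (MvPolynomial (Fin n) ℤ)} {Mθ : Matrix (Fin (q * q)) (Fin (q * q)) ℂ}
    (hdet : Mθ.det = aeval θ N) {z : Fin (q * q)}
    (hadj : ∀ a' : Fin (q * q), Mθ.adjugate z a' = aeval θ (M.adjugate z a'))
    {E : ℤ} (hE1 : 1 ≤ E) {δe : ℕ}
    (hNlen : mvlen N ≤ ((q * q).factorial : ℤ) * E ^ (q * q)) (hNdeg : N.totalDegree ≤ (q * q) * δe)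
    (hadjB : ∀ a' : Fin (q * q), mvlen (M.adjugate z a') ≤ ((q * q).factorial : ℤ) * E ^ (q * q) ∧
      (M.adjugate z a').totalDegree ≤ (q * q) * δe)
    {Θ : ℝ} (hΘ1 : 1 ≤ Θ) (hθΘ : ∀ i, ‖θ i‖ ≤ Θ) {w : Fin (q * q) → ℂ} (hw : ∀ a', ‖w a'‖ ≤ Θ ^ q * Θ ^ q)
    {Φ : ℂ} (hfact : Mθ.det = Φ * ∑ a' : Fin (q * q), Mθ.adjugate z a' * w a')
    {Kl dJ : ℝ} (hKl : 0 ≤ Kl) (hd0 : 0 ≤ dJ) {J : ℕ} (hΦ : ‖Φ‖ ≤ (q : ℝ) ^ J * (Kl * dJ))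
    {A : ℕ} (hA : A = A₀ + 1) (hdistle : dJ ≤ Real.exp (-Real.exp (((q : ℝ) ^ 2) ^ (A + 1))))
    {K p Bρ : ℕ} {LP : ℤ} (hLP1 : 1 ≤ LP) (hpB : p ≤ Bρ * q)
    (hEdef : E = ((K : ℤ) + 1) ^ 2 * (LP * ((p : ℤ) + q) ^ J))
    {cE cN cU c₃ a : ℝ} (hcE : cE = 2 * ((K : ℝ) + 1) + LP + J * ((Bρ : ℝ) + 1)) (hcN : cN = cE + 2)
    (hcU : cU = ((J : ℝ) + 2) + cE + Θ * ((δe : ℝ) + 2)) (hc₃ : c₃ = (Kl + 1) + cU + cN)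
    (ha : a = A * ((δe : ℝ) + 1) ^ A) {Q₁ : ℕ} (hQ₁ : c₃ + 2 + a < Q₁) (hqqN : Q₁ ≤ q * q) : False := by
  have hA1 : 1 ≤ A := by omega
  have hq1r : (1 : ℝ) ≤ q := by exact_mod_cast hq
  have hq0r : (0 : ℝ) < q := by positivity
  have hqsq : (q : ℝ) ≤ (q : ℝ) ^ 2 := by nlinarith only [hq1r]
  have hq2 : (1 : ℝ) ≤ (q : ℝ) ^ 2 := hq1r.trans hqsq
  have hQcast : ((q * q : ℕ) : ℝ) = (q : ℝ) ^ 2 := by push_cast; ring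
  have hQsq : (q : ℝ) ^ 2 ≤ ((q : ℝ) ^ 2) ^ 2 := by nlinarith only [hq2]
  have hQ2 : (1 : ℝ) ≤ ((q : ℝ) ^ 2) ^ 2 := hq2.trans hQsq
  have hqQsq : (q : ℝ) ≤ ((q : ℝ) ^ 2) ^ 2 := hqsq.trans hQsq
  have hΘ0 : 0 ≤ Θ := by linarith
  have hLP1r : (1 : ℝ) ≤ LP := by exact_mod_cast hLP1
  have hcE0 : 0 ≤ cE := by rw [hcE]; positivity
  have hcN0 : 0 ≤ cN := by rw [hcN]; positivity
  have hcU0 : 0 ≤ cU := by rw [hcU]; positivity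
  have ha0 : 0 ≤ a := by rw [ha]; positivity
  have hc₃0 : 0 ≤ c₃ := by rw [hc₃]; positivity
  have hEr : (E : ℝ) ≤ Real.exp (2 * ((K : ℝ) + 1) + LP + J * (((Bρ : ℝ) + 1) * q)) := by
    have h1 : ((K : ℝ) + 1) ^ 2 ≤ Real.exp (2 * ((K : ℝ) + 1)) := by
      have := pow_le_exp_mul (show (0:ℝ) ≤ (K : ℝ) + 1 by positivity) 2
      simpa using this
    have h2 : (LP : ℝ) ≤ Real.exp (LP : ℝ) := by linarith [Real.add_one_le_exp (LP : ℝ)]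
    have h3 : ((p : ℝ) + q) ^ J ≤ Real.exp (J * (((Bρ : ℝ) + 1) * q)) := by
      have hpq' : (p : ℝ) + q ≤ ((Bρ : ℝ) + 1) * q := by
        have : (p : ℝ) ≤ Bρ * q := by exact_mod_cast hpB
        linarith
      exact (pow_le_pow_left₀ (by positivity) hpq' J).trans (pow_le_exp_mul (by positivity) J)
    have key : ((K : ℝ) + 1) ^ 2 * ((LP : ℝ) * ((p : ℝ) + q) ^ J) ≤
        Real.exp (2 * ((K : ℝ) + 1)) * (Real.exp (LP : ℝ) * Real.exp (J * (((Bρ : ℝ) + 1) * q))) :=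
      mul_le_mul h1 (mul_le_mul h2 h3 (by positivity) (Real.exp_pos _).le) (by positivity)
        (Real.exp_pos _).le
    have hEcast : (E : ℝ) = ((K : ℝ) + 1) ^ 2 * ((LP : ℝ) * ((p : ℝ) + q) ^ J) := by
      rw [hEdef]; push_cast; ring
    rw [hEcast]
    calc _ ≤ _ := key
      _ = Real.exp (2 * ((K : ℝ) + 1) + LP + J * (((Bρ : ℝ) + 1) * q)) := by
          rw [← Real.exp_add, ← Real.exp_add]; congr 1; ring
  have hE0r : (0 : ℝ) ≤ E := by exact_mod_cast (zero_le_one.trans hE1)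
  have hEq : (E : ℝ) ^ (q * q) ≤ Real.exp (cE * ((q : ℝ) ^ 2) ^ 2) := by
    refine (pow_le_pow_left₀ hE0r hEr (q * q)).trans ?_
    rw [← Real.exp_nat_mul, Real.exp_le_exp, hQcast, hcE]
    have t1 : (2 * ((K : ℝ) + 1)) * (q : ℝ) ^ 2 ≤ (2 * ((K : ℝ) + 1)) * ((q : ℝ) ^ 2) ^ 2 :=
      mul_le_mul_of_nonneg_left hQsq (by positivity)
    have t2 : (LP : ℝ) * (q : ℝ) ^ 2 ≤ (LP : ℝ) * ((q : ℝ) ^ 2) ^ 2 := mul_le_mul_of_nonneg_left hQsq (by linarith)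
    have t3 : (q : ℝ) ^ 2 * (J * (((Bρ : ℝ) + 1) * q)) ≤ J * ((Bρ : ℝ) + 1) * ((q : ℝ) ^ 2) ^ 2 := by
      have : (q : ℝ) ^ 2 * q ≤ (q : ℝ) ^ 2 * (q : ℝ) ^ 2 := mul_le_mul_of_nonneg_left hqsq (by positivity)
      nlinarith only [this, show (0:ℝ) ≤ J * ((Bρ : ℝ) + 1) by positivity]
    nlinarith only [t1, t2, t3]
  have hfac : (((q * q).factorial : ℕ) : ℝ) ≤ Real.exp (((q : ℝ) ^ 2) ^ 2) := by
    have h1 : (((q * q).factorial : ℕ) : ℝ) ≤ ((q * q : ℕ) : ℝ) ^ (q * q) := by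
      exact_mod_cast Nat.factorial_le_pow (q * q)
    refine h1.trans ?_
    rw [hQcast]
    refine (pow_le_exp_mul (by positivity) (q * q)).trans (le_of_eq ?_)
    rw [hQcast, sq ((q : ℝ) ^ 2)]
  have hΘpow : ∀ k : ℕ, Θ ^ k ≤ Real.exp (k * Θ) := fun k => pow_le_exp_mul hΘ0 k
  -- (3) lower bound from the measure
  have hlow : Real.exp (-(cN * ((q : ℝ) ^ 2) ^ 2 * Real.exp (a * ((q : ℝ) ^ 2) ^ A))) ≤ ‖aeval θ N‖ := by
    refine le_trans ?_ (hA₀ N hN0)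
    rw [Real.exp_le_exp, neg_le_neg_iff]
    have hlen : Real.log (mvlen N : ℝ) + 1 ≤ cN * ((q : ℝ) ^ 2) ^ 2 := by
      have h1 : (mvlen N : ℝ) ≤ Real.exp (((q : ℝ) ^ 2) ^ 2) * Real.exp (cE * ((q : ℝ) ^ 2) ^ 2) := by
        have : (mvlen N : ℝ) ≤ (((q * q).factorial : ℕ) : ℝ) * (E : ℝ) ^ (q * q) := by exact_mod_cast hNlen
        exact this.trans (mul_le_mul hfac hEq (by positivity) (Real.exp_pos _).le)
      have h2 : (0 : ℝ) < mvlen N := by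
        have := one_le_mvlen hN0
        exact_mod_cast (show (0 : ℤ) < mvlen N by omega)
      have h3 : Real.log (mvlen N : ℝ) ≤ ((q : ℝ) ^ 2) ^ 2 + cE * ((q : ℝ) ^ 2) ^ 2 := by
        rw [← Real.exp_add] at h1
        exact (Real.log_le_log h2 h1).trans_eq (Real.log_exp _)
      rw [hcN]; linarith only [h3, hQ2]
    have hdeg : (A₀ : ℝ) * ((N.totalDegree : ℝ) + 1) ^ A₀ ≤ a * ((q : ℝ) ^ 2) ^ A := by
      have h1 : (N.totalDegree : ℝ) + 1 ≤ ((δe : ℝ) + 1) * (q : ℝ) ^ 2 := by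
        have : (N.totalDegree : ℝ) ≤ ((q * q : ℕ) : ℝ) * δe := by exact_mod_cast hNdeg
        rw [hQcast] at this
        linarith only [this, hq2]
      have hδq1 : (1 : ℝ) ≤ ((δe : ℝ) + 1) * (q : ℝ) ^ 2 :=
        one_le_mul_of_one_le_of_one_le (by linarith only [Nat.cast_nonneg (α := ℝ) δe]) hq2
      have h2 : ((N.totalDegree : ℝ) + 1) ^ A₀ ≤ (((δe : ℝ) + 1) * (q : ℝ) ^ 2) ^ A := by
        refine (pow_le_pow_left₀ (by positivity) h1 A₀).trans ?_
        exact pow_le_pow_right₀ hδq1 (by omega)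
      have h3 : (A₀ : ℝ) ≤ A := by rw [hA]; push_cast; linarith
      rw [ha]
      rw [mul_pow] at h2
      calc (A₀ : ℝ) * ((N.totalDegree : ℝ) + 1) ^ A₀
          ≤ (A : ℝ) * ((((δe : ℝ) + 1)) ^ A * ((q : ℝ) ^ 2) ^ A) :=
            mul_le_mul h3 h2 (by positivity) (by positivity)
        _ = (A : ℝ) * ((δe : ℝ) + 1) ^ A * ((q : ℝ) ^ 2) ^ A := by ring
    have hlen0 : 0 ≤ Real.log (mvlen N : ℝ) + 1 := by
      have : (1 : ℝ) ≤ mvlen N := by exact_mod_cast (one_le_mvlen hN0)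
      linarith [Real.log_nonneg this]
    calc (Real.log (mvlen N : ℝ) + 1) * Real.exp ((A₀ : ℝ) * ((N.totalDegree : ℝ) + 1) ^ A₀)
        ≤ (cN * ((q : ℝ) ^ 2) ^ 2) * Real.exp (a * ((q : ℝ) ^ 2) ^ A) :=
          mul_le_mul hlen (Real.exp_le_exp.2 hdeg) (Real.exp_pos _).le (by positivity)
      _ = cN * ((q : ℝ) ^ 2) ^ 2 * Real.exp (a * ((q : ℝ) ^ 2) ^ A) := by ring
  -- (4) upper bound from the factorisation
  have hup : ‖aeval θ N‖ ≤ (Kl + 1) * Real.exp (cU * ((q : ℝ) ^ 2) ^ 2) *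
      Real.exp (-Real.exp (((q : ℝ) ^ 2) ^ (A + 1))) := by
    set T : ℝ := ((((q * q).factorial : ℕ) : ℝ) * (E : ℝ) ^ (q * q)) * Θ ^ ((q * q) * δe) * (Θ ^ q * Θ ^ q)
      with hT
    have hS : ‖∑ a' : Fin (q * q), Mθ.adjugate z a' * w a'‖ ≤
        ((q * q : ℕ) : ℝ) * T := by
      refine (norm_sum_le _ _).trans ?_
      have hterm : ∀ a' : Fin (q * q),
          ‖Mθ.adjugate z a' * w a'‖ ≤ T := by
        intro a'
        rw [norm_mul, hadj, hT]
        have h1 := norm_mvaeval_le_mvlen (M.adjugate z a') θ hΘ1 hθΘ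
        have h2 : (mvlen (M.adjugate z a') : ℝ) ≤ (((q * q).factorial : ℕ) : ℝ) * (E : ℝ) ^ (q * q) := by
          exact_mod_cast (hadjB a').1
        have h3 : Θ ^ (M.adjugate z a').totalDegree ≤ Θ ^ ((q * q) * δe) :=
          pow_le_pow_right₀ hΘ1 (hadjB a').2
        have h4 : ‖w a'‖ ≤ Θ ^ q * Θ ^ q := hw a'
        have h0 : (0 : ℝ) ≤ (mvlen (M.adjugate z a') : ℝ) := by
          exact_mod_cast mvlen_nonneg _
        calc ‖aeval θ (M.adjugate z a')‖ * ‖w a'‖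
            ≤ ((mvlen (M.adjugate z a') : ℝ) * Θ ^ (M.adjugate z a').totalDegree) * (Θ ^ q * Θ ^ q) :=
              mul_le_mul h1 h4 (by positivity) (by positivity)
          _ ≤ ((((q * q).factorial : ℕ) : ℝ) * (E : ℝ) ^ (q * q)) * Θ ^ ((q * q) * δe) * (Θ ^ q * Θ ^ q) := by
              refine mul_le_mul_of_nonneg_right ?_ (by positivity)
              exact mul_le_mul h2 h3 (by positivity) (by positivity)
      calc ∑ a' : Fin (q * q), ‖Mθ.adjugate z a' * w a'‖
          ≤ ∑ _a' : Fin (q * q), T := Finset.sum_le_sum fun a' _ => hterm a'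
        _ = ((q * q : ℕ) : ℝ) * T := by
            rw [Finset.sum_const, Finset.card_univ, Fintype.card_fin, nsmul_eq_mul]
    have hT0 : 0 ≤ T := by rw [hT]; positivity
    have hjunk : (q : ℝ) ^ J * (((q * q : ℕ) : ℝ) * T) ≤ Real.exp (cU * ((q : ℝ) ^ 2) ^ 2) := by
      have h1 : (q : ℝ) ^ J ≤ Real.exp (J * ((q : ℝ) ^ 2) ^ 2) :=
        (pow_le_exp_mul hq0r.le J).trans (by
          rw [Real.exp_le_exp]; exact mul_le_mul_of_nonneg_left hqQsq (Nat.cast_nonneg J))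
      have h2 : ((q * q : ℕ) : ℝ) ≤ Real.exp (((q : ℝ) ^ 2) ^ 2) := by
        rw [hQcast]
        exact (by linarith [Real.add_one_le_exp ((q : ℝ) ^ 2)] : (q : ℝ) ^ 2 ≤ Real.exp ((q : ℝ) ^ 2)).trans
          (Real.exp_le_exp.2 hQsq)
      have h3 := hfac
      have h4 := hEq
      have h5 : Θ ^ ((q * q) * δe) * (Θ ^ q * Θ ^ q) ≤ Real.exp (Θ * (((δe : ℝ) + 2)) * ((q : ℝ) ^ 2) ^ 2) := by
        rw [← pow_add, ← pow_add]
        refine (hΘpow _).trans ?_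
        rw [Real.exp_le_exp]
        push_cast
        have e1 : (q : ℝ) * q * δe ≤ ((q : ℝ) ^ 2) ^ 2 * δe := by
          rw [← sq]; exact mul_le_mul_of_nonneg_right hQsq (Nat.cast_nonneg δe)
        calc ((q : ℝ) * q * δe + (q + q)) * Θ = ((q : ℝ) * q * δe + q + q) * Θ := by ring
          _ ≤ (((q : ℝ) ^ 2) ^ 2 * δe + ((q : ℝ) ^ 2) ^ 2 + ((q : ℝ) ^ 2) ^ 2) * Θ :=
              mul_le_mul_of_nonneg_right (by linarith) hΘ0
          _ = Θ * ((δe : ℝ) + 2) * ((q : ℝ) ^ 2) ^ 2 := by ring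
      calc (q : ℝ) ^ J * (((q * q : ℕ) : ℝ) * T)
          = (q : ℝ) ^ J * ((q * q : ℕ) : ℝ) * (((q * q).factorial : ℕ) : ℝ) * (E : ℝ) ^ (q * q) *
              (Θ ^ ((q * q) * δe) * (Θ ^ q * Θ ^ q)) := by rw [hT]; ring
        _ ≤ Real.exp (J * ((q : ℝ) ^ 2) ^ 2) * Real.exp (((q : ℝ) ^ 2) ^ 2) * Real.exp (((q : ℝ) ^ 2) ^ 2) *
            Real.exp (cE * ((q : ℝ) ^ 2) ^ 2) * Real.exp (Θ * ((δe : ℝ) + 2) * ((q : ℝ) ^ 2) ^ 2) := by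
            gcongr
        _ = Real.exp (cU * ((q : ℝ) ^ 2) ^ 2) := by
            simp only [← Real.exp_add]; congr 1; rw [hcU]; ring
    calc ‖aeval θ N‖ = ‖Mθ.det‖ := by rw [hdet]
      _ = ‖Φ‖ * ‖∑ a' : Fin (q * q), Mθ.adjugate z a' * w a'‖ := by rw [hfact, norm_mul]
      _ ≤ ((q : ℝ) ^ J * (Kl * dJ)) * (((q * q : ℕ) : ℝ) * T) :=
          mul_le_mul hΦ hS (by positivity) (by positivity)
      _ = Kl * ((q : ℝ) ^ J * (((q * q : ℕ) : ℝ) * T)) * dJ := by ring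
      _ ≤ (Kl + 1) * Real.exp (cU * ((q : ℝ) ^ 2) ^ 2) * Real.exp (-Real.exp (((q : ℝ) ^ 2) ^ (A + 1))) := by
          refine mul_le_mul (mul_le_mul (by linarith) hjunk (by positivity) (by positivity)) hdistle
            hd0 (by positivity)
  -- (5) the clash: g30's `kernel_clash_ineq` at `q² = q·q` in place of `q`
  have hclash := kernel_clash_ineq (q := q * q) hKl hcU0 ha0 hc₃ hc₃0 hA1 (by rw [hQcast]; exact hq2)
    (by rw [hQcast]; positivity) (by rw [hQcast]; exact hQ2) hQ₁ hqqN
  rw [hQcast] at hclash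
  exact absurd (hlow.trans hup) (not_le.2 hclash)

end Kernel

end Summit.Schanuel.Schanuel.Theorems.RootDecomp1BTwoRadical

end
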